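import Summits.CriticalPhenomena.CardyFormulaZ2.Theses.CardyUSTContinuation
import Summits.CriticalPhenomena.CardyFormulaZ2.Theorems.CardyUSTContinuationUniformAnalyticExtensionStubRiemann
import Literature.Probability.LatticeModels.FKTwoArcPartitionPolynomials
import HarnessLib

/-!
# Stub `stub_ratioToCrux` of the line `registered` (birth skeleton v3) for the crux
# `UniformAnalyticExtension` (stmt-CriticalPhenomena-6047, route `CardyUSTContinuation`)

The NORMAL FORM of the crux, direction "polynomial bound ⇒ crux".  The crux asks, for every
conformal rectangle `R` and `t₁ ∈ (0,1)`, for `ρ > 0`, `M` and, eventually as `δ → 0⁺`, an analytic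
`g_δ` on the complex `ρ`-neighbourhood `U_ρ` of `[t₁, 1]` with `‖g_δ‖ ≤ M` and
`g_δ(t) = u_R(t, δ)` on `[t₁, 1]`, where `u_R(t, δ)` is the jointly-wired self-dual FK crossing
probability.  By the Literature reduction `measureReal_fkDomainMeasure_discreteCrossing`,
`u_R(t, δ) = N_δ(t)/Z_δ(t)` for `δ, t > 0` with `N_δ, Z_δ ∈ ℕ[X]` the two-arc crossing / partition
polynomials.  We prove: a δ-uniform bound `‖N_δ(z)/Z_δ(z)‖ ≤ M` on `U_ρ` for the junk-valued complex
quotient implies the crux — the bounded quotient has only removable singularities (the engine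
`stub_riemann`, Riemann's theorem packaged for an open set), its regularisation inherits the bound
`M` through the punctured limits, and on the real segment, where `Z_δ(t) > 0`, it is the quotient itself.

The converse (crux ⇒ ratio bound, identity theorem on the convex set `U_ρ`) is recorded in the line
skeleton; together they say the ratio bound is EQUIVALENT to the crux.
-/

noncomputable section

open Filter Topology Set Polynomial Metric
open Literature.Probability.LatticeModels
open Literature.Probability.RandomPlanarGeometry (ConformalRectangle)

namespace Summit.CriticalPhenomena.CardyFormulaZ2.Cruxes.UniformAnalyticExtension.Birth

/-- Pushing the Literature reduction `u = N_δ/Z_δ` through `ℝ → ℂ`: evaluation of an `ℕ[X]` at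
`↑t` is the cast of its evaluation at `t`. [folklore] -/
theorem ratioToCrux_ofReal_aeval_natPoly (P : ℕ[X]) (t : ℝ) :
    ((aeval t P : ℝ) : ℂ) = aeval (t : ℂ) P := by
  rw [← Complex.coe_algebraMap, aeval_algebraMap_apply]

/-- For `δ > 0` and real `t > 0` the two-arc partition polynomial is positive at `t` (it is a
nonempty sum of powers of `t`: the empty configuration contributes). [folklore] -/
theorem ratioToCrux_aeval_partition_pos (R : ConformalRectangle) {δ : ℝ} (hδ : 0 < δ)
    {t : ℝ} (ht : 0 < t) (w : ArcWiring) :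
    0 < aeval t (fkTwoArcPartitionPolynomials R δ w) := by
  classical
  letI : Fintype (meshDomain R.carrier δ) := (meshDomain_finite R.isBounded hδ).fintype
  rw [fkTwoArcPartitionPolynomials_of_pos R hδ, aeval_rcArcPolynomial]
  exact Finset.sum_pos (fun ω _ => pow_pos ht _) ⟨∅, Finset.empty_mem_powerset _⟩

/-- A nonzero polynomial over `ℕ`, evaluated in `ℂ`, is nonzero on a punctured neighbourhood of
every point (it has finitely many complex roots). [folklore] -/
theorem ratioToCrux_eventually_aeval_ne_zero (P : ℕ[X]) (hP : P ≠ 0) (z : ℂ) :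
    ∀ᶠ w in 𝓝[≠] z, aeval w P ≠ 0 := by
  have hmap : P.map (algebraMap ℕ ℂ) ≠ 0 :=
    (Polynomial.map_ne_zero_iff (algebraMap ℕ ℂ).injective_nat).2 hP
  have hfin : ({x : ℂ | IsRoot (P.map (algebraMap ℕ ℂ)) x} \ {z}).Finite :=
    (finite_setOf_isRoot hmap).subset sdiff_subset
  have hopen : IsOpen ({x : ℂ | IsRoot (P.map (algebraMap ℕ ℂ)) x} \ {z})ᶜ := hfin.isClosed.isOpen_compl
  have hz : z ∈ ({x : ℂ | IsRoot (P.map (algebraMap ℕ ℂ)) x} \ {z})ᶜ := fun h => h.2 rfl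
  have h1 : ∀ᶠ w in 𝓝 z, w ∈ ({x : ℂ | IsRoot (P.map (algebraMap ℕ ℂ)) x} \ {z})ᶜ :=
    hopen.mem_nhds hz
  have h2 : ∀ᶠ w in 𝓝[≠] z, w ≠ z := self_mem_nhdsWithin
  filter_upwards [nhdsWithin_le_nhds h1, h2] with w hw hwz
  intro h0
  apply hw
  refine ⟨?_, hwz⟩
  change (P.map (algebraMap ℕ ℂ)).eval w = 0
  rwa [eval_map, ← aeval_def]

/-- **stub_ratioToCrux** (normal form of the crux `UniformAnalyticExtension`, direction ⇒): if for
every conformal rectangle `R` and `t₁ ∈ (0,1)` there are `ρ > 0` and `M` such that for all small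
`δ > 0` the junk-valued complex crossing ratio `N_δ(z)/Z_δ(z)` is bounded by `M` on the
`ρ`-neighbourhood of `[t₁, 1] ⊂ ℂ`, then the crux holds (with the same `ρ`, `M` and the Riemann
regularisation of `N_δ/Z_δ` as the analytic extension of `u_R(·, δ)`).  The conclusion is the BODY
of the route decl `…Theses.CardyUSTContinuation.UniformAnalyticExtension` with its `let uJ := …`
ζ/β-reduced (definitionally equal to it; the line skeleton closes the named crux from this by
`exact`). [folklore] -/
theorem stub_ratioToCrux :
    (∀ R : ConformalRectangle, ∀ t₁ ∈ Set.Ioo (0:ℝ) 1, ∃ ρ > (0:ℝ), ∃ M : ℝ, ∀ᶠ δ in 𝓝[>] (0:ℝ),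
      ∀ z ∈ thickening ρ (((↑) : ℝ → ℂ) '' Set.Icc t₁ 1),
        ‖aeval z (fkTwoArcCrossingPolynomial R δ ArcWiring.joint) /
            aeval z (fkTwoArcPartitionPolynomials R δ ArcWiring.joint)‖ ≤ M) →
      (∀ R : Literature.Probability.RandomPlanarGeometry.ConformalRectangle, ∀ t₁ ∈ Set.Ioo (0:ℝ) 1,
        ∃ ρ > (0:ℝ), ∃ M : ℝ, ∀ᶠ δ in 𝓝[>] (0:ℝ), ∃ g : ℂ → ℂ,
          DifferentiableOn ℂ g (Metric.thickening ρ (((↑) : ℝ → ℂ) '' Set.Icc t₁ 1)) ∧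
          (∀ z ∈ Metric.thickening ρ (((↑) : ℝ → ℂ) '' Set.Icc t₁ 1), ‖g z‖ ≤ M) ∧
          ∀ t ∈ Set.Icc t₁ 1, g t =
            ((if h : 0 < δ then (@Literature.Probability.LatticeModels.fkDomainMeasure R.carrier δ
                (t / (1 + t)) (t ^ 2) (R.arc 0 ∪ R.arc 2)
                (Literature.Probability.LatticeModels.meshDomain_finite R.isBounded h).fintype).real
                (Literature.Probability.Percolation.discreteCrossing R.carrier δ (R.arc 0) (R.arc 2))
              else 0 : ℝ) : ℂ)) := by
  intro h
  show Summit.CriticalPhenomena.CardyFormulaZ2.Theses.CardyUSTContinuation.UniformAnalyticExtension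
  intro R t₁ ht₁
  obtain ⟨ρ, hρ, M, hev⟩ := h R t₁ ht₁
  refine ⟨ρ, hρ, M, ?_⟩
  filter_upwards [hev, self_mem_nhdsWithin] with δ hδb hδ
  have hδ' : (0:ℝ) < δ := hδ
  set S : Set ℂ := ((↑) : ℝ → ℂ) '' Set.Icc t₁ 1 with hSdef
  set N := fkTwoArcCrossingPolynomial R δ ArcWiring.joint with hNdef
  set Z := fkTwoArcPartitionPolynomials R δ ArcWiring.joint with hZdef
  set f : ℂ → ℂ := fun w => aeval w N / aeval w Z with hfdef
  have hZ0 : Z ≠ 0 := fkTwoArcPartitionPolynomials_ne_zero R hδ' _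
  -- differentiability of `f` off the (finitely many) roots of `Z`
  have hd : ∀ z ∈ thickening ρ S, ∀ᶠ w in 𝓝[≠] z, DifferentiableAt ℂ f w := by
    intro z _
    filter_upwards [ratioToCrux_eventually_aeval_ne_zero Z hZ0 z] with w hw
    exact ((Polynomial.differentiable_aeval N) w).div ((Polynomial.differentiable_aeval Z) w) hw
  -- the uniform bound holds in particular on punctured neighbourhoods (the thickening is open)
  have hbM : ∀ z ∈ thickening ρ S, ∀ᶠ w in 𝓝[≠] z, ‖f w‖ ≤ M := by
    intro z hz
    filter_upwards [mem_nhdsWithin_of_mem_nhds (isOpen_thickening.mem_nhds hz)] with w hw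
    exact hδb w hw
  have hb : ∀ z ∈ thickening ρ S, ∃ C : ℝ, ∀ᶠ w in 𝓝[≠] z, ‖f w‖ ≤ C :=
    fun z hz => ⟨M, hbM z hz⟩
  obtain ⟨g, hg, hT⟩ := stub_riemann (thickening ρ S) f isOpen_thickening hd hb
  have hgU : ∀ z ∈ thickening ρ S, ‖g z‖ ≤ M :=
    fun z hz => le_of_tendsto ((hT z hz).norm) (hbM z hz)
  refine ⟨g, hg, hgU, ?_⟩
  -- restriction to the real segment, where `Z_δ(t) > 0`
  intro t ht
  have ht0 : 0 < t := ht₁.1.trans_le ht.1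
  have htS : (t : ℂ) ∈ thickening ρ S := self_subset_thickening hρ S ⟨t, ht, rfl⟩
  have hZt : aeval (t : ℂ) Z ≠ 0 := by
    rw [← ratioToCrux_ofReal_aeval_natPoly, Complex.ofReal_ne_zero]
    exact (ratioToCrux_aeval_partition_pos R hδ' ht0 _).ne'
  have hfc : ContinuousAt f (t : ℂ) :=
    ((Polynomial.differentiable_aeval N) _).continuousAt.div
      ((Polynomial.differentiable_aeval Z) _).continuousAt hZt
  have hgt : g (t : ℂ) = f (t : ℂ) :=
    tendsto_nhds_unique (hT _ htS) (hfc.tendsto.mono_left nhdsWithin_le_nhds)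
  rw [hgt]
  simp only [hfdef, dif_pos hδ']
  rw [@measureReal_fkDomainMeasure_discreteCrossing R δ hδ' t ht0
      ((meshDomain_finite R.isBounded hδ').fintype),
    Complex.ofReal_div, ratioToCrux_ofReal_aeval_natPoly, ratioToCrux_ofReal_aeval_natPoly]

end Summit.CriticalPhenomena.CardyFormulaZ2.Cruxes.UniformAnalyticExtension.Birth
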